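import Literature.Algebra.Homology.KunnethMapIso
import Literature.Algebra.Homology.KunnethDirectSum
import Literature.AlgebraicGeometry.Modules.ModuleCechComplex
import Mathlib.Algebra.Category.ModuleCat.EpiMono
import HarnessLib

/-!
# (K½) F4-S — Künneth INJECTIVITY on cohomology from a cochain-level retraction (SOCKETS, HOME seed #3)

Cell `hodgecm-mathlib`, F-11 generic HOME-seed #3 (desk B-p13 (g20) 15:12:14Z; director s286/s287 terms: HOME-only,
nothing files this run, provisional path `Literature/AlgebraicGeometry/Modules/CechKunnethInjective.lean`).  Author A-p01 (g11).
HC_CM is proved only modulo the 7 printed citations until rung 0 closes; this file proves no cell binder.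

The (K½) plan (A-p04 (g19) SOCKETS memo `A-provers/A-p04/g19/K12/SOCKETS-K12-KunnethInjectivity.A-p04g19.md` dbca3edc,
§2 and §6 RE-CUT): for finite affine covers `𝓤`, `𝓥` of separated `k`-schemes `X`, `Y` and the product cover `𝔚` of `X ×_k Y`,
F1 supplies the product-cover carrier and F2 supplies cochain maps `cross : Č(𝓤) ⊗ Č(𝓥) ⟶ Č(𝔚)` (ordered cup of the two
pull-backs) and `shuffleRetraction : Č(𝔚) ⟶ Č(𝓤) ⊗ Č(𝓥)` with `cross ≫ shuffleRetraction = 𝟙` (Eilenberg–Mac Lane,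
dualised; on the nose for ORDERED complexes).  THIS file is the S-sized head F4: from ANY such pair the Künneth map
`⊕_{i+j=n} Hⁱ(Č(𝓤)) ⊗_k Hʲ(Č(𝓥)) → Hⁿ(Č(𝔚))`, `[a] ⊗ [b] ↦ [a × b]`, is INJECTIVE — by the tree's ★ Künneth isomorphism over a
field (`KunnethMapIso.isIso_kunnethMap`, bounded complexes) composed with the split monomorphism `Hⁿ(cross)`.

* §1 `mono_homologyMap_of_retraction` / `homologyMap_injective_of_retraction` — a cochain map with a retraction is a split
  mono on every homology object (any shape, any commutative ring).
* §2 `mono_kunnethMap_comp_homologyMap` / `injective_kunnethMap_comp_homologyMap` /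
  `injective_homologyMap_comp_kunnethLinearEquiv` — over a field, for bounded `C`, `D` and `cross : C ⊗ D ⟶ E` with a retraction,
  `∐_{i+j=n} Hⁱ(C) ⊗ Hʲ(D) ⟶ Hⁿ(E)` is a monomorphism (categorical, function, and `⨁`-`LinearEquiv` forms).
* §3 `injective_cechKunneth_of_cross_retraction` — the same at `C := Modules.cechComplex 𝓤 L ρ`, `D := Modules.cechComplex 𝓥 M ρ'`
  (★ `Modules/ModuleCechComplex`, bounded in `[0, #ι−1]` by ★ `isStrictlyGE_cechComplex` / `isStrictlyLE_cechComplex`), `E` ANY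
  complex (the consumer takes `E := Modules.cechComplex 𝔚 𝒪 ρ_Z`): F1/F2's outputs enter ONLY as the binders `cross`, `ret`, `h`.
* §4 (letter only, see the end): the EVEN-part `Algebra.TensorProduct.productMap p₁^* p₂^*` form that F5 / F0
  `Literature.Algebra.Bialgebra.eq_zero_of_map_eq_add_of_isNilpotent` (A-p04, bb4c68c0) consumes.

References: [Weibel1994] C. Weibel, *An introduction to homological algebra*, Thm. 3.6.3 (and, for the cross∕shuffle
background, S. Eilenberg, S. Mac Lane, Ann. of Math. 58 (1953) §§5–6 — not cited below); [GortzWedhorn2023] U. Görtz, T. Wedhorn, *Algebraic Geometry II*, Def. 21.68, Cor. 22.110.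
-/

noncomputable section

-- `GradedObject`/`HomologicalComplex₂.toGradedObject` are not reducible (as in the tree's `KunnethMap.lean`).
set_option backward.isDefEq.respectTransparency false

open CategoryTheory CategoryTheory.Category CategoryTheory.Limits HomologicalComplex

universe u

namespace Literature.Algebra.Homology

/-! ### §1 Retractions give split monomorphisms on homology -/

section Retraction

variable {R : Type u} [CommRing R] {ι : Type*} {c : ComplexShape ι}
  {K L : HomologicalComplex (ModuleCat.{u} R) c}

/-- A cochain map `f` with a retraction `r` (`f ≫ r = 𝟙`) induces a (split) MONOMORPHISM `Hⁿ(f)` on every homology object.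
[cite: Weibel1994, Thm. 3.6.3 (proof: split injections)] -/
theorem mono_homologyMap_of_retraction (f : K ⟶ L) (r : L ⟶ K) (h : f ≫ r = 𝟙 K) (n : ι) :
    Mono (homologyMap f n) := by
  haveI : IsSplitMono (homologyMap f n) :=
    IsSplitMono.mk' ⟨homologyMap r n, by rw [← homologyMap_comp, h, homologyMap_id]⟩
  infer_instance

/-- Function form of `mono_homologyMap_of_retraction`: `Hⁿ(f)` is injective. [cite: Weibel1994, Thm. 3.6.3 (proof)] -/
theorem homologyMap_injective_of_retraction (f : K ⟶ L) (r : L ⟶ K) (h : f ≫ r = 𝟙 K) (n : ι) :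
    Function.Injective (homologyMap f n) :=
  (ModuleCat.mono_iff_injective _).mp (mono_homologyMap_of_retraction f r h n)

end Retraction

/-! ### §2 Over a field: the Künneth map followed by `Hⁿ(cross)` is a monomorphism -/

section Field

variable {k : Type u} [Field k] (C D : CochainComplex (ModuleCat.{u} k) ℤ) {E : CochainComplex (ModuleCat.{u} k) ℤ}

/-- **Künneth injectivity from a retraction (categorical form).**  For bounded cochain complexes `C`, `D` of `k`-vector
spaces and a cochain map `cross : C ⊗ D ⟶ E` admitting a retraction, the composite
`∐_{i+j=n} Hⁱ(C) ⊗ Hʲ(D) ⟶ Hⁿ(C ⊗ D) ⟶ Hⁿ(E)` (`[z] ⊗ [w] ↦ [cross (z ⊗ w)]`) is a monomorphism.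
[cite: Weibel1994, Thm. 3.6.3] -/
theorem mono_kunnethMap_comp_homologyMap (a₁ b₁ a₂ b₂ : ℤ) [C.IsStrictlyGE a₁] [C.IsStrictlyLE b₁] [D.IsStrictlyGE a₂]
    [D.IsStrictlyLE b₂] (n : ℤ) (cross : HomologicalComplex.tensorObj C D ⟶ E)
    (ret : E ⟶ HomologicalComplex.tensorObj C D) (h : cross ≫ ret = 𝟙 _) :
    Mono (kunnethMap C D n ≫ homologyMap cross n) := by
  haveI := isIso_kunnethMap C D a₁ b₁ a₂ b₂ n
  haveI := mono_homologyMap_of_retraction cross ret h n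
  exact mono_comp _ _

/-- **Künneth injectivity from a retraction (function form).** [cite: Weibel1994, Thm. 3.6.3] -/
theorem injective_kunnethMap_comp_homologyMap (a₁ b₁ a₂ b₂ : ℤ) [C.IsStrictlyGE a₁] [C.IsStrictlyLE b₁] [D.IsStrictlyGE a₂]
    [D.IsStrictlyLE b₂] (n : ℤ) (cross : HomologicalComplex.tensorObj C D ⟶ E)
    (ret : E ⟶ HomologicalComplex.tensorObj C D) (h : cross ≫ ret = 𝟙 _) :
    Function.Injective (kunnethMap C D n ≫ homologyMap cross n) :=
  (ModuleCat.mono_iff_injective _).mp (mono_kunnethMap_comp_homologyMap C D a₁ b₁ a₂ b₂ n cross ret h)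

/-- **Künneth injectivity from a retraction (direct-sum form)**: `x ↦ Hⁿ(cross) (κₙ x)` on `⨁_{i+j=n} Hⁱ(C) ⊗_k Hʲ(D)` is injective,
`κₙ` the tree's `kunnethLinearEquiv` (`[z] ⊗ [w] ↦ [z ⊗ w]` on each summand, `kunnethLinearEquiv_lof`).
[cite: Weibel1994, Thm. 3.6.3] -/
theorem injective_homologyMap_comp_kunnethLinearEquiv (a₁ b₁ a₂ b₂ : ℤ) [C.IsStrictlyGE a₁] [C.IsStrictlyLE b₁]
    [D.IsStrictlyGE a₂] [D.IsStrictlyLE b₂] (n : ℤ) (cross : HomologicalComplex.tensorObj C D ⟶ E)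
    (ret : E ⟶ HomologicalComplex.tensorObj C D) (h : cross ≫ ret = 𝟙 _) :
    Function.Injective (fun x => homologyMap cross n (kunnethLinearEquiv C D a₁ b₁ a₂ b₂ n x)) :=
  (homologyMap_injective_of_retraction cross ret h n).comp (kunnethLinearEquiv C D a₁ b₁ a₂ b₂ n).injective

end Field

end Literature.Algebra.Homology

/-! ### §3 The Čech instantiation (F1/F2 outputs as binders) -/

namespace Literature.AlgebraicGeometry.Modules

open _root_.AlgebraicGeometry _root_.TopologicalSpace Opposite Literature.Algebra.Homology

variable {k : Type u} [Field k]
  {X : Scheme.{u}} {ι : Type} [LinearOrder ι] [Fintype ι] (𝓤 : ι → X.Opens) (L : X.Modules) (ρ : k →+* Γ(X, ⊤))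
  {Y : Scheme.{u}} {ι' : Type} [LinearOrder ι'] [Fintype ι'] (𝓥 : ι' → Y.Opens) (M : Y.Modules) (ρ' : k →+* Γ(Y, ⊤))
  {E : CochainComplex (ModuleCat.{u} k) ℤ}

/-- **(K½) head, sockets form.**  For the ordered module Čech complexes `Č(𝓤, L)`, `Č(𝓥, M)` of `k`-vector spaces of two
FINITE covers (★ `Modules.cechComplex`; any sheaves of modules `L`, `M`, any `k`-structures `ρ`, `ρ'`) and ANY cochain map
`cross : Č(𝓤, L) ⊗ Č(𝓥, M) ⟶ E` with a retraction `ret` (F2's `cross` / `shuffleRetraction` on the product cover, `E := Č(𝔚, 𝒪_{X×Y})`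
through F1's carrier), the map `⨁_{i+j=n} Hⁱ(Č(𝓤, L)) ⊗_k Hʲ(Č(𝓥, M)) → Hⁿ(E)`, `x ↦ Hⁿ(cross)(κₙ x)`, is INJECTIVE.
[cite: Weibel1994, Thm. 3.6.3] [cite: GortzWedhorn2023, Def. 21.68 (p. 180), Cor. 22.110] -/
theorem injective_cechKunneth_of_cross_retraction (n : ℤ)
    (cross : HomologicalComplex.tensorObj (cechComplex 𝓤 L ρ) (cechComplex 𝓥 M ρ') ⟶ E)
    (ret : E ⟶ HomologicalComplex.tensorObj (cechComplex 𝓤 L ρ) (cechComplex 𝓥 M ρ')) (h : cross ≫ ret = 𝟙 _) :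
    haveI := isStrictlyGE_cechComplex 𝓤 L ρ
    haveI := isStrictlyLE_cechComplex 𝓤 L ρ (Fintype.card ι : ℤ) (by omega)
    haveI := isStrictlyGE_cechComplex 𝓥 M ρ'
    haveI := isStrictlyLE_cechComplex 𝓥 M ρ' (Fintype.card ι' : ℤ) (by omega)
    Function.Injective (fun x => homologyMap cross n
      (kunnethLinearEquiv (cechComplex 𝓤 L ρ) (cechComplex 𝓥 M ρ') 0 (Fintype.card ι : ℤ) 0 (Fintype.card ι' : ℤ) n x)) := by
  haveI := isStrictlyGE_cechComplex 𝓤 L ρ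
  haveI := isStrictlyLE_cechComplex 𝓤 L ρ (Fintype.card ι : ℤ) (by omega)
  haveI := isStrictlyGE_cechComplex 𝓥 M ρ'
  haveI := isStrictlyLE_cechComplex 𝓥 M ρ' (Fintype.card ι' : ℤ) (by omega)
  exact injective_homologyMap_comp_kunnethLinearEquiv _ _ 0 (Fintype.card ι : ℤ) 0 (Fintype.card ι' : ℤ) n cross ret h

end Literature.AlgebraicGeometry.Modules

/-! ### §4 LETTER for the consumer F5 (not elaborated here; needs F2's ordered cup product)
With F2's cup on EVEN classes making `R := ⊕_d H^{2d}(Č(𝓤', 𝒪_X))` and `S := ⊕_d H^{2d}(Č(𝔚', 𝒪_{X×X}))` commutative `k`-algebras and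
`p₁^*, p₂^*, m^* : R →ₐ[k] S` algebra maps (A-p04 SOCKETS §3 (A)–(C), cover `𝔚' = {p₁⁻¹U_i ∩ p₂⁻¹U_j ∩ m⁻¹U_k}`), the identity
`Algebra.TensorProduct.productMap p₁^* p₂^* (a ⊗ b) = H(ρ) (a × b)` on `H^{2d} ⊗ H^{2d'}` reduces
`Function.Injective (Algebra.TensorProduct.productMap p₁^* p₂^*)` — the hypothesis of F0 `eq_zero_of_map_eq_add_of_isNilpotent` — to
§3 summand by summand (`TensorProduct.directSum` splits `R ⊗ R = ⊕_{d,d'} H^{2d} ⊗ H^{2d'}`; the summands `(2d, 2d')` with `2d+2d' = n`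
inject into `⨁_{i+j=n}`; `H(ρ)` is the refinement ISO `H(Č(𝔚)) ≅ H(Č(𝔚'))`, both covers having affine faces).  Size S (≈ 80 l.) once F2 lands. -/
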